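import Summits.CriticalPhenomena.PercolationContinuityZ3.Theorems.PercNearOneGluingNoHeavyLowerTailSahiClassTCoreReduction
import Summits.CriticalPhenomena.PercolationContinuityZ3.Theorems.PercNearOneGluingNoHeavyLowerTailSahiJuntaSlotLeThree
import Mathlib.Tactic.Linarith
import HarnessLib

/-!
# `NoHeavyLowerTail` (crux stmt-CriticalPhenomena-4575), P2 — the open core, III: **every member of an open-core triple is essential on at least FOUR coordinates**

Support file (seat `prim-masterthm-p2`, gen 14; `--supports stmt-CriticalPhenomena-4575`).  No definition, no `sorry`, standard axioms.

P3's junta-slot theorem (`SahiJuntaSlotThree.sahiE_three_nonneg_of_determinedBy_card_le_three`, standard axioms): if ONE member of an increasing triple is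
determined by at most three coordinates, `E_3 ≥ 0` whatever the other two members are.  An increasing event is determined by its essential support
(`determinedBy_esupp`), so with the core reduction (`SahiClassTCube.masterFamilyNonneg_three_iff_core`):

* **`masterFamilyNonneg_three_iff_core_four`** — Kahn's Conjecture 5 (`MasterFamilyNonneg 3`) ⟺ `C_3` for CORE triples (a coordinate essential to all three members, no
  canalyzing and no private essential coordinate) in which EVERY member has at least four essential coordinates.
The computational sharpening to FIVE (P3's `…SahiTransportJRFour`, `native_decide` certificates) is the companion file `…SahiClassTCoreJuntaFour`.
HONEST FRAMING: a reduction; `C_3` on the core remains OPEN. [this work]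
-/

noncomputable section

open scoped Classical

namespace Summit.CriticalPhenomena.PercolationContinuityZ3.Theorems

namespace SahiClassTCube

open Finset Function
open Literature.Combinatorics.Sahi2008
open Literature.Probability.Percolation.DecisionTree (ind)

variable {κ : Type} [Fintype κ]

/-- A member with at most three essential coordinates settles `C_3` for the triple (P3's junta slot, any slot by symmetry). [this work] -/
theorem sahiE_three_nonneg_of_card_esupp_le_three (p : κ → unitInterval) (U : Fin 3 → Set (Set κ)) (hU : ∀ j, IsUpperSet (U j))
    {j : Fin 3} (hj : (esupp (U j)).card ≤ 3) : 0 ≤ sahiE (bernoulliWeight p) 3 (fun i => ind (U i)) := by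
  let σ : Equiv.Perm (Fin 3) := Equiv.swap 0 j
  have e0 : σ 0 = j := Equiv.swap_apply_left 0 j
  rw [← sahiE_three_ind_comp_perm (bernoulliWeight p) σ U]
  have hj' : (esupp (U (σ 0))).card ≤ 3 := by rw [e0]; exact hj
  have h' := SahiJuntaSlotThree.sahiE_three_nonneg_of_determinedBy_card_le_three p (esupp (U (σ 0))) hj'
    (determinedBy_esupp (hU (σ 0))) (hU (σ 0)) (hU (σ 1)) (hU (σ 2))
  rw [← Pointwise.ind_vec3, vec3_eta (fun i => U (σ i))] at h'
  exact h'

/-- **THE OPEN CORE HAS MEMBERS WITH ≥ 4 ESSENTIAL COORDINATES.**  `MasterFamilyNonneg 3` (⟺ `KahnConjecture`) ⟺ `C_3` for core triples all of whose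
members have at least four essential coordinates. [this work] -/
theorem masterFamilyNonneg_three_iff_core_four :
    MasterFamilyNonneg 3 ↔
      ∀ (κ : Type) [Fintype κ] (p : κ → unitInterval) (U : Fin 3 → Set (Set κ)), (∀ j, IsUpperSet (U j)) →
        (∃ x, x ∈ esupp (U 0) ∧ x ∈ esupp (U 1) ∧ x ∈ esupp (U 2)) →
        (∀ j x, x ∈ esupp (U j) → ¬ ({ω : Set κ | x ∈ ω} ⊆ U j) ∧ ¬ (U j ⊆ {ω : Set κ | x ∈ ω})) →
        (∀ j x, x ∈ esupp (U j) → ∃ j', j' ≠ j ∧ x ∈ esupp (U j')) →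
        (∀ j, 4 ≤ (esupp (U j)).card) →
        0 ≤ sahiE (bernoulliWeight p) 3 (fun j => ind (U j)) := by
  rw [masterFamilyNonneg_three_iff_core]
  constructor
  · intro h κ _ p U hU h1 h2 h3 _
    exact h κ p U hU h1 h2 h3
  · intro h κ _ p U hU h1 h2 h3
    by_cases hsmall : ∃ j, (esupp (U j)).card ≤ 3
    · obtain ⟨j, hj⟩ := hsmall
      exact sahiE_three_nonneg_of_card_esupp_le_three p U hU hj
    · push Not at hsmall
      exact h κ p U hU h1 h2 h3 fun j => by have := hsmall j; omega

end SahiClassTCube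

end Summit.CriticalPhenomena.PercolationContinuityZ3.Theorems
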